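import Mathlib
import Literature.MathematicalPhysics.QuantumFieldTheory.Balaban1983to89.B6Decomp247Surfaces

/-!
# `Balaban1983to89.B6Decomp247AnySurfaces` — [Balaban1984PropagatorsII] (2.47)–(2.48) pp. 231–232 for an ARBITRARY
# family of surface point sets Σ_j between the crossing points and the zone-j points: the decomposition (2.47) and both
# lines of (2.48) hold WHATEVER lattice reading of *"T^{(j)} ∩ Σ_j = Λ_j ∩ Σ_j"* is adopted (companion of
# `…B6Decomp247Surfaces`, which fixes Σ_j := the crossing points `OnSurf`)

statement-level skeleton of published theorems with citation tags; proofs where landed; nothing here is a claim about the Yang–Mills mass gap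

CITATION HEADER (lean-in-tree rule 2026-08-18).  Source: T. Bałaban, *Propagators and renormalization transformations for
lattice gauge theories. II*, Commun. Math. Phys. **96**, 223–250 (1984), doi:10.1007/bf01240221 [Balaban1984PropagatorsII]
(cell paper B6; held `paper:balaban1984-cmp96-propagators-rt-ii`, journal page = PDF page + 222; pp. 231–232 [PDF 9–10]
read AS IMAGES on the ×2 renders `run/shared/lean/pub/pub-balaban/b2b-balaban-ref1/pages/1984-cmp96-propagators-rt-II/
…-p009-x2.png`, `…-p010-x2.png`, 2026-08-21).  lit-balaban SKELETON row **B6.Eq2.47**; unit `lit-balaban-r03` (gen 7),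
HOME `run/shared/lean/pub/lit-balaban/`.  IMPORTS, NOT MODIFIED: `…B6Decomp247Surfaces` (same unit, p266990: the
dictionary `OnSurf`, the zone rules, the first-hitting index `nxt`, the portion lengths `len` with `dist_le_len` ∕
`len_le_of_bonds` ∕ `inv_mul_len_le`, `scaleLen_mono_pos` — all reused BY NAME), through it `…B6Geometry` (`Separates`,
`ContourSystem`, `Realizes`), `…B6LevelGapMetric` (`BondScale`, `BondScale22`), `…B6LevelTower` (the (k+1)-level tower).
The printed text of pp. 231–232 ((2.46), the surfaces Σ_j, the construction of y_l, y′_l, j_l, (2.47), (2.48)) is quoted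
verbatim in the header of `…B6Decomp247Surfaces`; it is not repeated here.

THE POINT.  `…B6Decomp247Surfaces` reads the lattice point set *"T^{(j)} ∩ Σ_j = Λ_j ∩ Σ_j"* (p. 231) as `OnSurf j` = the
points of B^j(Λ_j) joined by an admissible bond to a point of B^{j−1}(Λ_{j−1}) — the points at which an admissible contour
can pass between the two zones (its typing note (a): the printed surface Σ_j = ∂Ω_j may carry further lattice points, e.g.
at corners where two cubes of Ω_j meet along an edge, through which no admissible contour changes zone).  THIS FILE removes
that choice: the whole construction and every printed property of (2.47), and both lines of (2.48), are re-proved for an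
ARBITRARY family `S : ℕ → V → Prop` of surface point sets subject only to the two facts the print states about Σ_j —
(α) `hSz`: a point of Σ_j is a point of Λ_j ∕ zone j (*"T^{(j)} ∩ Σ_j = Λ_j ∩ Σ_j"*, closed-Ω convention of the
`B6Geometry` dictionary), and (β) `hSc`: every crossing point lies on Σ_j (`OnSurf G zone j x → S j x`; p. 231 *"The surface
Σ_j separates the sets B^j(Λ_j) and B^{j−1}(Λ_{j−1})"*: a Λ_{j−1}-bond from Ω_{j−1} ∖ Ω_j into Ω_j ends on ∂Ω_j = Σ_j).
Between these bounds — from the crossing points alone (`S := OnSurf G zone`, `admissible_onSurf`) up to all of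
B^j(Λ_j) (`S j x := zone x = j`, `admissible_allPoints`) — the printed decomposition exists with all its properties and
(2.48) holds; in particular for the print's Σ_j ∩ lattice whatever its corner points are.

WHAT IS PROVED (kernel-checked; no `sorry`; standard axioms; 0 new `def … : Prop` facts).  §1–2: `SurfAt S p i` (the i-th
point of the contour lies on some Σ_j of the family), `surfAt_of_onSomeSurf` ∕ `not_onSomeSurf_of_not_surfAt` (β), and —
with the index machinery of the sibling (`nxt`) — the printed construction relative to S: `aIdx S zone p` (y₁ = first
point on a surface of S; y_{l+1} = first point on a surface other than Σ_{j_l}), `js`, `m`, `eIdx`, `bIdx` (y′_l = the LAST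
point on Σ_{j_l} before another surface), `bSet`; the properties: `onSurf_aIdx`/`onSurf_bIdx` (y_l, y′_l ∈ Σ_{j_l}, using
(α)), `zone_eq_js_of_surfAt_S`/`not_onSurf_S` (Γ_{y_l,y′_l} meets no Σ_j with j ≠ j_l), `not_surfAt_X`/`not_surfAt_tail`/
`not_surfAt_of_lt_aIdx_one`, the surface-free `stretch` lemma (using (β): a point on no surface of S is not a crossing
point, so the zone rules of the sibling apply), `X_facts` (every bond of Γ_{y′_l,y_{l+1}} is a Λ_{min(j_l,j_{l+1})}-bond,
|j_l − j_{l+1}| ≤ 1), `js_succ_ne`/`js_step` (|j_l − j_{l+1}| = 1), `js_one_bounds` (y₁ ∈ Σ_j ∪ Σ_{j+1}), `js_m_bounds`,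
`S_zone`/`S_bond_le` (Γ_{y_l,y′_l} ⊂ B^{j_l}(Λ_{j_l}) ∪ B^{j_l−1}(Λ_{j_l−1})).  §3: `ineq248_line1`, `ineq248_line2`,
`rhs248Len`/`rhs248Pts`, `ineq248_walk`, `ineq248_dist` — (2.48) both lines for the S-decomposition of every contour and
for the distance with a shortest contour.  §4: `decomp247` (all of (2.47) as one statement, hypotheses (α), (β) and
`Separates`), `admissible_onSurf` ∕ `admissible_allPoints` + closing `example`s (the two extreme admissible families — non-vacuity of (α), (β)),
`ineq248_of_realizes` (over `ContourSystem`/`Realizes`/`BondScale22`, ℓ j = L^jη, L ≥ 1, η > 0), `ineq248_tower` (the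
(k+1)-level tower of `B6LevelTower`, every admissible S).

TYPING ∕ SCOPE.  As in the sibling: finite combinatorics of walks in a zoned graph plus the triangle inequality of a
drawing; Γ = ⋃ portions is definitional (index intervals); everything holds for EVERY admissible contour, and for a
shortest one |Γ|_bonds = d(y, y′); j_{m+1} := j′; (len) as an inequality; no use of (2.2)/(2.57)/(2.58).  NOT the nested
domains in a torus, NOT Lemma 2.1, NOT anything analytic, NOT progress on any Clay problem.
-/

namespace Literature.MathematicalPhysics.QuantumFieldTheory.Balaban1983to89.B6Decomp247AnySurfaces

open Literature.MathematicalPhysics.QuantumFieldTheory.Balaban1983to89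
open B6Geometry B6LevelGapMetric Finset
open Literature.MathematicalPhysics.QuantumFieldTheory.Balaban1983to89.B6Decomp247Surfaces (OnSurf OnSomeSurf onSurf_of_onSomeSurf onSurf_iff zone_le_of_adj_of_not_onSomeSurf
  zone_le_of_adj_of_not_onSomeSurf_left zone_eq_of_adj_of_not_onSomeSurf nxt nxt_spec le_nxt nxt_le_of_mem nxt_le_max
  prop_nxt_of_le not_prop_of_lt_nxt len len_nonneg dist_le_len len_le_of_bonds inv_mul_len_le scaleLen_mono_pos)

/-! ## 1.–2. The construction of (2.47) for an ARBITRARY family of surface point sets Σ_j containing the crossing points -/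

section Walk

variable {V : Type*} {G : SimpleGraph V} {zone : V → ℕ} {S : ℕ → V → Prop} {x x' : V}

/-- The i-th point of the contour is a surface point for the surface sets S. [cite: Balaban1984PropagatorsII, (2.47) p.231] -/
def SurfAt (S : ℕ → V → Prop) (p : G.Walk x x') (i : ℕ) : Prop :=
  ∃ j, S j (p.getVert i)

/-- A crossing point (a point of some `OnSurf j`) is a surface point of any admissible surface family S.
[cite: Balaban1984PropagatorsII, p.231] -/
theorem surfAt_of_onSomeSurf {S : ℕ → V → Prop} (hSc : ∀ ⦃j : ℕ⦄ ⦃y : V⦄, OnSurf G zone j y → S j y)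
    (p : G.Walk x x') {i : ℕ} (h : OnSomeSurf G zone (p.getVert i)) : SurfAt S p i :=
  ⟨_, hSc (onSurf_of_onSomeSurf h)⟩

/-- A point on no surface of S is not a crossing point. [cite: Balaban1984PropagatorsII, p.231] -/
theorem not_onSomeSurf_of_not_surfAt {S : ℕ → V → Prop} (hSc : ∀ ⦃j : ℕ⦄ ⦃y : V⦄, OnSurf G zone j y → S j y)
    (p : G.Walk x x') {i : ℕ} (h : ¬ SurfAt S p i) : ¬ OnSomeSurf G zone (p.getVert i) :=
  fun h' => h (surfAt_of_onSomeSurf hSc p h')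

/-- The surface through the i-th point is Σ_{zone}. [cite: Balaban1984PropagatorsII, p.231] -/
theorem zone_eq_of_surf {S : ℕ → V → Prop} (hSz : ∀ ⦃j : ℕ⦄ ⦃y : V⦄, S j y → zone y = j)
    (p : G.Walk x x') {i j : ℕ} (h : S j (p.getVert i)) : zone (p.getVert i) = j :=
  hSz h

/-- The indices of the points y_l of (2.47) along the contour (aIdx 0 = 0 is the start y; aIdx 1 = the first surface
point; aIdx (l+2) = the first point after y_{l+1} on a surface OTHER than Σ_{j_{l+1}}). [cite: Balaban1984PropagatorsII, (2.47) p.231] -/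
noncomputable def aIdx (S : ℕ → V → Prop) (zone : V → ℕ) (p : G.Walk x x') : ℕ → ℕ
  | 0 => 0
  | 1 => nxt p 0 (SurfAt S p)
  | (l + 2) => nxt p (aIdx S zone p (l + 1) + 1)
      (fun i => SurfAt S p i ∧ zone (p.getVert i) ≠ zone (p.getVert (aIdx S zone p (l + 1))))

/-- The surface indices j_l of (2.47): j_l = zone y_l (j₀ = j = zone y). [cite: Balaban1984PropagatorsII, (2.47) p.231] -/
noncomputable def js (S : ℕ → V → Prop) (zone : V → ℕ) (p : G.Walk x x') (l : ℕ) : ℕ := zone (p.getVert (aIdx S zone p l))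

/-- y₀ = y. [cite: Balaban1984PropagatorsII, (2.47) p.231] -/
theorem aIdx_zero (p : G.Walk x x') : aIdx S zone p 0 = 0 := rfl

/-- y₁ = the first surface point of the contour. [cite: Balaban1984PropagatorsII, (2.47) p.231] -/
theorem aIdx_one (p : G.Walk x x') : aIdx S zone p 1 = nxt p 0 (SurfAt S p) := rfl

/-- y_{l+2} = the first point after y_{l+1} on a surface other than Σ_{j_{l+1}}. [cite: Balaban1984PropagatorsII, (2.47) p.231] -/
theorem aIdx_succ_succ (p : G.Walk x x') (l : ℕ) : aIdx S zone p (l + 2) = nxt p (aIdx S zone p (l + 1) + 1)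
    (fun i => SurfAt S p i ∧ zone (p.getVert i) ≠ js S zone p (l + 1)) := rfl

/-- j₀ = j = zone y. [cite: Balaban1984PropagatorsII, (2.47) p.231] -/
theorem js_zero (p : G.Walk x x') : js S zone p 0 = zone x := by
  simp [js, aIdx_zero]

/-- The indices y_l increase strictly from l = 1 on. [cite: Balaban1984PropagatorsII, (2.47) p.231] -/
theorem aIdx_lt_succ (p : G.Walk x x') (l : ℕ) (hl : 1 ≤ l) : aIdx S zone p l < aIdx S zone p (l + 1) := by
  obtain ⟨l, rfl⟩ : ∃ l', l = l' + 1 := ⟨l - 1, by omega⟩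
  rw [aIdx_succ_succ]
  exact Nat.lt_of_lt_of_le (Nat.lt_succ_self _) (le_nxt p _ _)

/-- The index of y_{l+1} is at least l. [cite: Balaban1984PropagatorsII, (2.47) p.231] -/
theorem le_aIdx (p : G.Walk x x') (l : ℕ) : l ≤ aIdx S zone p (l + 1) := by
  induction l with
  | zero => exact Nat.zero_le _
  | succ l ih => have := aIdx_lt_succ (S := S) (zone := zone) p (l + 1) (by omega); omega

/-- The episode indices eventually leave the contour (finitely many episodes). [cite: Balaban1984PropagatorsII, (2.47) p.231] -/
theorem exists_aIdx_gt (p : G.Walk x x') : ∃ l, p.length < aIdx S zone p (l + 1) :=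
  ⟨p.length + 1, by have := le_aIdx (S := S) (zone := zone) p (p.length + 1); omega⟩

open Classical in
/-- **m** of (2.47): the number of surface episodes y_l … y′_l of the contour. [cite: Balaban1984PropagatorsII, (2.47) p.231] -/
noncomputable def m (S : ℕ → V → Prop) (zone : V → ℕ) (p : G.Walk x x') : ℕ := Nat.find (exists_aIdx_gt (S := S) (zone := zone) p)

open Classical in
/-- There is no (m+1)-st episode on the contour. [cite: Balaban1984PropagatorsII, (2.47) p.231] -/
theorem length_lt_aIdx_m_succ (p : G.Walk x x') : p.length < aIdx S zone p (m S zone p + 1) :=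
  Nat.find_spec (exists_aIdx_gt (S := S) (zone := zone) p)

open Classical in
/-- The episodes 1, …, m lie on the contour. [cite: Balaban1984PropagatorsII, (2.47) p.231] -/
theorem aIdx_le_length (p : G.Walk x x') {l : ℕ} (hl1 : 1 ≤ l) (hl : l ≤ m S zone p) : aIdx S zone p l ≤ p.length := by
  obtain ⟨l, rfl⟩ : ∃ l', l = l' + 1 := ⟨l - 1, by omega⟩
  have hlt : l < m S zone p := by omega
  unfold m at hlt
  have h := Nat.find_min (exists_aIdx_gt (S := S) (zone := zone) p) hlt
  omega

/-- The end index of the l-th crossing portion: e l = aIdx l for l ≤ m, and e (m+1) = |Γ| (y_{m+1} = y′).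
[cite: Balaban1984PropagatorsII, (2.47) p.231] -/
noncomputable def eIdx (S : ℕ → V → Prop) (zone : V → ℕ) (p : G.Walk x x') (l : ℕ) : ℕ := min (aIdx S zone p l) p.length

/-- e_l = index of y_l for 1 ≤ l ≤ m. [cite: Balaban1984PropagatorsII, (2.47) p.231] -/
theorem eIdx_of_le (p : G.Walk x x') {l : ℕ} (hl1 : 1 ≤ l) (hl : l ≤ m S zone p) : eIdx S zone p l = aIdx S zone p l :=
  min_eq_left (aIdx_le_length p hl1 hl)

/-- e_{m+1} = |Γ|: y_{m+1} = y′. [cite: Balaban1984PropagatorsII, (2.47) p.231] -/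
theorem eIdx_m_succ (p : G.Walk x x') : eIdx S zone p (m S zone p + 1) = p.length :=
  min_eq_right (length_lt_aIdx_m_succ p).le

/-- e_l ≤ |Γ|. [cite: Balaban1984PropagatorsII, (2.47) p.231] -/
theorem eIdx_le_length (p : G.Walk x x') (l : ℕ) : eIdx S zone p l ≤ p.length := min_le_right _ _

/-- The indices of the points y′_l of (2.47): the LAST point on Σ_{j_l} before the contour meets another surface
(b 0 = 0 is the start y). [cite: Balaban1984PropagatorsII, (2.47) p.231] -/
noncomputable def bIdx (S : ℕ → V → Prop) (zone : V → ℕ) (p : G.Walk x x') (l : ℕ) : ℕ :=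
  if l = 0 then 0 else
    sSup {i | aIdx S zone p l ≤ i ∧ i ≤ p.length ∧ i < aIdx S zone p (l + 1) ∧ SurfAt S p i ∧
      zone (p.getVert i) = js S zone p l}

/-- b₀ = 0: y′₀ := y. [cite: Balaban1984PropagatorsII, (2.47) p.231] -/
theorem bIdx_zero (p : G.Walk x x') : bIdx S zone p 0 = 0 := by simp [bIdx]

/-! ## 3. The decomposition (2.47): the printed properties of the portions Γ_{y_l,y′_l}, Γ_{y′_l,y_{l+1}} -/

/-- Γ(e_l) = y_l (the point at index min{aIdx l, |Γ|}; beyond the contour both are y′). [cite: Balaban1984PropagatorsII, (2.47) p.231] -/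
theorem getVert_eIdx (p : G.Walk x x') (l : ℕ) : p.getVert (eIdx S zone p l) = p.getVert (aIdx S zone p l) := by
  unfold eIdx
  rcases le_total (aIdx S zone p l) p.length with h | h
  · rw [min_eq_left h]
  · rw [min_eq_right h, p.getVert_of_length_le le_rfl, p.getVert_of_length_le h]

/-- zone y_l = j_l (also for l = m + 1: zone y′ = j_{m+1}). [cite: Balaban1984PropagatorsII, (2.47) p.231] -/
theorem zone_getVert_eIdx (p : G.Walk x x') (l : ℕ) : zone (p.getVert (eIdx S zone p l)) = js S zone p l := by
  rw [getVert_eIdx]; rfl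

/-- j_{m+1} = j′ = zone y′. [cite: Balaban1984PropagatorsII, (2.47) p.231] -/
theorem js_m_succ (p : G.Walk x x') : js S zone p (m S zone p + 1) = zone x' := by
  rw [js, p.getVert_of_length_le (length_lt_aIdx_m_succ p).le]

/-- y_l (1 ≤ l ≤ m) is a surface point. [cite: Balaban1984PropagatorsII, (2.47) p.231] -/
theorem surfAt_aIdx (p : G.Walk x x') {l : ℕ} (hl1 : 1 ≤ l) (hl : l ≤ m S zone p) : SurfAt S p (aIdx S zone p l) := by
  have hle := aIdx_le_length p hl1 hl
  rcases Nat.lt_or_ge l 2 with h2 | h2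
  · obtain rfl : l = 1 := by omega
    exact prop_nxt_of_le p (t := 0) (P := SurfAt S p) hle
  · obtain ⟨l, rfl⟩ : ∃ l', l = l' + 2 := ⟨l - 2, by omega⟩
    rw [aIdx_succ_succ] at hle ⊢
    exact (prop_nxt_of_le p hle).1

/-- **y_l ∈ Σ_{j_l}** (1 ≤ l ≤ m). [cite: Balaban1984PropagatorsII, (2.47) p.231] -/
theorem onSurf_aIdx (hSz : ∀ ⦃j : ℕ⦄ ⦃y : V⦄, S j y → zone y = j) (p : G.Walk x x') {l : ℕ} (hl1 : 1 ≤ l) (hl : l ≤ m S zone p) :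
    S (js S zone p l) (p.getVert (aIdx S zone p l)) := by
  obtain ⟨j, hj⟩ := surfAt_aIdx p hl1 hl
  have hjs : js S zone p l = j := hSz hj
  rw [hjs]; exact hj

/-- The defining set of the index of y′_l. [cite: Balaban1984PropagatorsII, (2.47) p.231] -/
def bSet (S : ℕ → V → Prop) (zone : V → ℕ) (p : G.Walk x x') (l : ℕ) : Set ℕ :=
  {i | aIdx S zone p l ≤ i ∧ i ≤ p.length ∧ i < aIdx S zone p (l + 1) ∧ SurfAt S p i ∧
    zone (p.getVert i) = js S zone p l}

/-- b_l is the supremum of its defining set (l ≥ 1). [cite: Balaban1984PropagatorsII, (2.47) p.231] -/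
theorem bIdx_of_pos (p : G.Walk x x') {l : ℕ} (hl1 : 1 ≤ l) : bIdx S zone p l = sSup (bSet S zone p l) := by
  unfold bIdx bSet
  rw [if_neg (by omega)]

/-- The defining set of b_l is bounded by |Γ|. [cite: Balaban1984PropagatorsII, (2.47) p.231] -/
theorem bSet_bddAbove (p : G.Walk x x') (l : ℕ) : BddAbove (bSet S zone p l) :=
  ⟨p.length, fun _ hi => hi.2.1⟩

/-- y_l itself is a candidate for y′_l. [cite: Balaban1984PropagatorsII, (2.47) p.231] -/
theorem aIdx_mem_bSet (p : G.Walk x x') {l : ℕ} (hl1 : 1 ≤ l) (hl : l ≤ m S zone p) : aIdx S zone p l ∈ bSet S zone p l :=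
  ⟨le_rfl, aIdx_le_length p hl1 hl, aIdx_lt_succ p l hl1, surfAt_aIdx p hl1 hl, rfl⟩

/-- y′_l is attained: the LAST point on Σ_{j_l} before another surface. [cite: Balaban1984PropagatorsII, (2.47) p.231] -/
theorem bIdx_mem_bSet (p : G.Walk x x') {l : ℕ} (hl1 : 1 ≤ l) (hl : l ≤ m S zone p) : bIdx S zone p l ∈ bSet S zone p l := by
  rw [bIdx_of_pos p hl1]
  exact Nat.sSup_mem ⟨_, aIdx_mem_bSet p hl1 hl⟩ (bSet_bddAbove p l)

/-- Maximality of y′_l. [cite: Balaban1984PropagatorsII, (2.47) p.231] -/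
theorem le_bIdx_of_mem_bSet (p : G.Walk x x') {l i : ℕ} (hl1 : 1 ≤ l) (hi : i ∈ bSet S zone p l) : i ≤ bIdx S zone p l := by
  rw [bIdx_of_pos p hl1]
  exact le_csSup (bSet_bddAbove p l) hi

/-- y_l comes no later than y′_l. [cite: Balaban1984PropagatorsII, (2.47) p.231] -/
theorem aIdx_le_bIdx (p : G.Walk x x') {l : ℕ} (hl1 : 1 ≤ l) (hl : l ≤ m S zone p) : aIdx S zone p l ≤ bIdx S zone p l :=
  le_bIdx_of_mem_bSet p hl1 (aIdx_mem_bSet p hl1 hl)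

/-- y′_l lies on the contour. [cite: Balaban1984PropagatorsII, (2.47) p.231] -/
theorem bIdx_le_length (p : G.Walk x x') {l : ℕ} (hl : l ≤ m S zone p) : bIdx S zone p l ≤ p.length := by
  rcases Nat.eq_zero_or_pos l with rfl | hl1
  · rw [bIdx_zero]; exact Nat.zero_le _
  · exact (bIdx_mem_bSet p hl1 hl).2.1

/-- y′_l comes strictly before y_{l+1}. [cite: Balaban1984PropagatorsII, (2.47) p.231] -/
theorem bIdx_lt_aIdx_succ (p : G.Walk x x') {l : ℕ} (hl1 : 1 ≤ l) (hl : l ≤ m S zone p) :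
    bIdx S zone p l < aIdx S zone p (l + 1) :=
  (bIdx_mem_bSet p hl1 hl).2.2.1

/-- b_l ≤ e_{l+1} (l ≤ m). [cite: Balaban1984PropagatorsII, (2.47) p.231] -/
theorem bIdx_le_eIdx_succ (p : G.Walk x x') {l : ℕ} (hl : l ≤ m S zone p) : bIdx S zone p l ≤ eIdx S zone p (l + 1) := by
  rcases Nat.eq_zero_or_pos l with rfl | hl1
  · rw [bIdx_zero]; exact Nat.zero_le _
  · exact le_min (bIdx_lt_aIdx_succ p hl1 hl).le (bIdx_le_length p hl)

/-- e_l ≤ b_l (1 ≤ l ≤ m). [cite: Balaban1984PropagatorsII, (2.47) p.231] -/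
theorem eIdx_le_bIdx (p : G.Walk x x') {l : ℕ} (hl1 : 1 ≤ l) (hl : l ≤ m S zone p) : eIdx S zone p l ≤ bIdx S zone p l := by
  rw [eIdx_of_le p hl1 hl]; exact aIdx_le_bIdx p hl1 hl

/-- **y′_l ∈ Σ_{j_l}** (1 ≤ l ≤ m). [cite: Balaban1984PropagatorsII, (2.47) p.231] -/
theorem onSurf_bIdx (hSz : ∀ ⦃j : ℕ⦄ ⦃y : V⦄, S j y → zone y = j) (p : G.Walk x x') {l : ℕ} (hl1 : 1 ≤ l) (hl : l ≤ m S zone p) :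
    S (js S zone p l) (p.getVert (bIdx S zone p l)) := by
  have h := bIdx_mem_bSet p hl1 hl
  obtain ⟨j, hj⟩ := h.2.2.2.1
  have hjs : js S zone p l = j := h.2.2.2.2.symm.trans (hSz hj)
  rw [hjs]; exact hj

/-- zone y′_l = j_l (l ≤ m; y′₀ = y). [cite: Balaban1984PropagatorsII, (2.47) p.231] -/
theorem zone_getVert_bIdx (p : G.Walk x x') {l : ℕ} (hl : l ≤ m S zone p) : zone (p.getVert (bIdx S zone p l)) = js S zone p l := by
  rcases Nat.eq_zero_or_pos l with rfl | hl1
  · rw [bIdx_zero, js_zero, p.getVert_zero]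
  · exact (bIdx_mem_bSet p hl1 hl).2.2.2.2

/-- The portion Γ_{y,y₁} before the first surface point meets no surface (y₁ = *"the first time"*).
[cite: Balaban1984PropagatorsII, (2.47) p.231] -/
theorem not_surfAt_of_lt_aIdx_one (p : G.Walk x x') {i : ℕ} (hi : i < aIdx S zone p 1) : ¬ SurfAt S p i :=
  (not_prop_of_lt_nxt p (t := 0) (P := SurfAt S p) (Nat.zero_le i) hi).2

/-- The interior of the crossing portion Γ_{y′_l,y_{l+1}} meets no surface at all (y′_l is the LAST point on Σ_{j_l},
y_{l+1} the FIRST point on another surface). [cite: Balaban1984PropagatorsII, (2.47) p.231] -/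
theorem not_surfAt_X (p : G.Walk x x') {l i : ℕ} (hl : l ≤ m S zone p) (h1 : bIdx S zone p l < i)
    (h2 : i < aIdx S zone p (l + 1)) (hin : i ≤ p.length) : ¬ SurfAt S p i := by
  rcases Nat.eq_zero_or_pos l with rfl | hl1
  · exact not_surfAt_of_lt_aIdx_one p h2
  · intro hs
    by_cases hz : zone (p.getVert i) = js S zone p l
    · have hmem : i ∈ bSet S zone p l := ⟨(aIdx_le_bIdx p hl1 hl).trans h1.le, hin, h2, hs, hz⟩
      exact absurd (le_bIdx_of_mem_bSet p hl1 hmem) (by omega)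
    · obtain ⟨l, rfl⟩ : ∃ l', l = l' + 1 := ⟨l - 1, by omega⟩
      rw [aIdx_succ_succ] at h2
      have hai : aIdx S zone p (l + 1) + 1 ≤ i := by
        have := aIdx_le_bIdx p hl1 hl
        omega
      have := nxt_le_of_mem p (P := fun i => SurfAt S p i ∧ zone (p.getVert i) ≠ js S zone p (l + 1)) hai
        (Or.inr ⟨hs, hz⟩)
      omega

/-- After y′_m the contour meets no surface (up to and including y′). [cite: Balaban1984PropagatorsII, (2.47) p.231] -/
theorem not_surfAt_tail (p : G.Walk x x') {i : ℕ} (h1 : bIdx S zone p (m S zone p) < i) (hin : i ≤ p.length) :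
    ¬ SurfAt S p i :=
  not_surfAt_X p le_rfl h1 (Nat.lt_of_le_of_lt hin (length_lt_aIdx_m_succ p)) hin

/-- **Γ_{y_l,y′_l} does not intersect any other surface Σ_j, j ≠ j_l.** [cite: Balaban1984PropagatorsII, (2.47) p.231] -/
theorem zone_eq_js_of_surfAt_S (p : G.Walk x x') {l i : ℕ} (hl1 : 1 ≤ l) (hl : l ≤ m S zone p)
    (h1 : aIdx S zone p l ≤ i) (h2 : i ≤ bIdx S zone p l) (hs : SurfAt S p i) : zone (p.getVert i) = js S zone p l := by
  rcases h1.eq_or_lt with h | h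
  · rw [← h]; rfl
  · by_contra hz
    obtain ⟨l, rfl⟩ : ∃ l', l = l' + 1 := ⟨l - 1, by omega⟩
    have hlt := bIdx_lt_aIdx_succ p hl1 hl
    rw [aIdx_succ_succ] at hlt
    have := nxt_le_of_mem p (P := fun i => SurfAt S p i ∧ zone (p.getVert i) ≠ js S zone p (l + 1))
      (show aIdx S zone p (l + 1) + 1 ≤ i by omega) (Or.inr ⟨hs, hz⟩)
    omega

/-- No point of Γ_{y_l,y′_l} lies on a surface Σ_j with j ≠ j_l. [cite: Balaban1984PropagatorsII, (2.47) p.231] -/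
theorem not_onSurf_S (hSz : ∀ ⦃j : ℕ⦄ ⦃y : V⦄, S j y → zone y = j) (p : G.Walk x x') {l i j : ℕ} (hl1 : 1 ≤ l) (hl : l ≤ m S zone p)
    (h1 : aIdx S zone p l ≤ i) (h2 : i ≤ bIdx S zone p l) (hj : j ≠ js S zone p l) : ¬ S j (p.getVert i) :=
  fun h => hj ((hSz h).symm.trans (zone_eq_js_of_surfAt_S p hl1 hl h1 h2 ⟨j, h⟩))

/-- Consecutive episodes sit on DIFFERENT surfaces. [cite: Balaban1984PropagatorsII, (2.47) p.231] -/
theorem js_succ_ne (p : G.Walk x x') {l : ℕ} (hl1 : 1 ≤ l) (hl : l + 1 ≤ m S zone p) :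
    js S zone p (l + 1) ≠ js S zone p l := by
  obtain ⟨l, rfl⟩ : ∃ l', l = l' + 1 := ⟨l - 1, by omega⟩
  have hle := aIdx_le_length p (l := l + 2) (by omega) hl
  rw [aIdx_succ_succ] at hle
  have h := (prop_nxt_of_le p hle).2
  rw [js, aIdx_succ_succ]
  exact h

/-- THE SURFACE-FREE STRETCH LEMMA: along a portion v_s … v_t of the contour whose interior points lie on no surface,
and whose end-points are not both points of one and the same surface, every bond has zone min{zone v_s, zone v_t},
the end zones differ by at most one, a surface-free start is the lower end and a surface-free finish is the lower end.
[cite: Balaban1984PropagatorsII, (2.47) p.231] -/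
theorem stretch (hsep : Separates G zone) (hSc : ∀ ⦃j : ℕ⦄ ⦃y : V⦄, OnSurf G zone j y → S j y) (p : G.Walk x x') {s t : ℕ} (hst : s ≤ t)
    (htn : t ≤ p.length)
    (hfree : ∀ i, s < i → i < t → ¬ SurfAt S p i)
    (hexcl : s < t → SurfAt S p s → SurfAt S p t → zone (p.getVert s) ≠ zone (p.getVert t)) :
    (∀ i, s ≤ i → i < t → min (zone (p.getVert i)) (zone (p.getVert (i + 1)))
        = min (zone (p.getVert s)) (zone (p.getVert t))) ∧
    zone (p.getVert s) ≤ zone (p.getVert t) + 1 ∧ zone (p.getVert t) ≤ zone (p.getVert s) + 1 ∧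
    (s < t → ¬ SurfAt S p s → zone (p.getVert s) ≤ zone (p.getVert t)) ∧
    (s < t → ¬ SurfAt S p t → zone (p.getVert t) ≤ zone (p.getVert s)) := by
  have hadj : ∀ i, i < t → G.Adj (p.getVert i) (p.getVert (i + 1)) := fun i hi =>
    p.adj_getVert_succ (by omega)
  rcases hst.eq_or_lt with rfl | hlt
  · refine ⟨fun i h1 h2 => by omega, by omega, by omega, fun h => by omega, fun h => by omega⟩
  -- the interior is zone-constant
  have hconst : ∀ i, s < i → i < t → zone (p.getVert i) = zone (p.getVert (s + 1)) := by
    intro i hi1 hi2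
    induction i, hi1 using Nat.le_induction with
    | base => rfl
    | succ i hsi ih =>
      have h := zone_eq_of_adj_of_not_onSomeSurf hsep (hadj i (by omega))
        (not_onSomeSurf_of_not_surfAt hSc p (hfree i hsi (by omega)))
        (not_onSomeSurf_of_not_surfAt hSc p (hfree (i + 1) (by omega) hi2))
      rw [← h, ih (by omega)]
  by_cases h1 : t = s + 1
  · subst h1
    have hb := hsep (hadj s (by omega))
    refine ⟨fun i hi1 hi2 => ?_, hb.2, hb.1, fun _ hs => ?_, fun _ ht => ?_⟩
    · obtain rfl : i = s := by omega
      rfl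
    · exact zone_le_of_adj_of_not_onSomeSurf_left hsep (hadj s (by omega)) (not_onSomeSurf_of_not_surfAt hSc p hs)
    · exact zone_le_of_adj_of_not_onSomeSurf hsep (hadj s (by omega)) (not_onSomeSurf_of_not_surfAt hSc p ht)
  · have h2 : s + 2 ≤ t := by omega
    set z := zone (p.getVert (s + 1)) with hz
    have hfs : ¬ SurfAt S p (s + 1) := hfree (s + 1) (by omega) (by omega)
    have hft : ¬ SurfAt S p (t - 1) := hfree (t - 1) (by omega) (by omega)
    have hzt1 : zone (p.getVert (t - 1)) = z := hconst (t - 1) (by omega) (by omega)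
    have hadj0 := hadj s (by omega)
    have hadj1 : G.Adj (p.getVert (t - 1)) (p.getVert t) := by
      have := hadj (t - 1) (by omega)
      rwa [show t - 1 + 1 = t by omega] at this
    -- first bond: no rise onto the surface-free v_{s+1}
    have hs1 : z ≤ zone (p.getVert s) :=
      zone_le_of_adj_of_not_onSomeSurf hsep hadj0 (not_onSomeSurf_of_not_surfAt hSc p hfs)
    have hs2 : zone (p.getVert s) ≤ z + 1 := (hsep hadj0).2
    -- last bond: no drop from the surface-free v_{t-1}
    have ht1 : z ≤ zone (p.getVert t) := by
      have := zone_le_of_adj_of_not_onSomeSurf_left hsep hadj1 (not_onSomeSurf_of_not_surfAt hSc p hft)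
      omega
    have ht2 : zone (p.getVert t) ≤ z + 1 := by
      have := (hsep hadj1).1
      omega
    -- an upper end-point is a surface point
    have hsurf_s : zone (p.getVert s) = z + 1 → SurfAt S p s := fun h =>
      surfAt_of_onSomeSurf hSc p ⟨p.getVert (s + 1), hadj0.symm, by omega⟩
    have hsurf_t : zone (p.getVert t) = z + 1 → SurfAt S p t := fun h =>
      surfAt_of_onSomeSurf hSc p ⟨p.getVert (t - 1), hadj1, by omega⟩
    have hnotboth : ¬ (zone (p.getVert s) = z + 1 ∧ zone (p.getVert t) = z + 1) := fun h =>
      hexcl hlt (hsurf_s h.1) (hsurf_t h.2) (by omega)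
    have hmin : min (zone (p.getVert s)) (zone (p.getVert t)) = z := by
      rcases Nat.lt_or_ge (zone (p.getVert s)) (z + 1) with h | h
      · have : zone (p.getVert s) = z := by omega
        rw [this]; exact min_eq_left ht1
      · have hs' : zone (p.getVert s) = z + 1 := by omega
        have : zone (p.getVert t) = z := by
          by_contra hne
          exact hnotboth ⟨hs', by omega⟩
        rw [this]; exact min_eq_right hs1
    refine ⟨fun i hi1 hi2 => ?_, by omega, by omega, fun _ hs => ?_, fun _ ht => ?_⟩
    · rw [hmin]
      rcases hi1.eq_or_lt with rfl | hi1'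
      · rw [← hz]; exact min_eq_right hs1
      · rw [hconst i hi1' hi2]
        by_cases hit : i + 1 = t
        · rw [hit]; exact min_eq_left ht1
        · rw [hconst (i + 1) (by omega) (by omega)]; exact min_self z
    · have := zone_le_of_adj_of_not_onSomeSurf_left hsep hadj0 (not_onSomeSurf_of_not_surfAt hSc p hs)
      omega
    · have := zone_le_of_adj_of_not_onSomeSurf hsep hadj1 (not_onSomeSurf_of_not_surfAt hSc p ht)
      omega

/-- **The crossing portion Γ_{y′_l,y_{l+1}} (l = 0, …, m; y′₀ = y, y_{m+1} = y′) is contained in B^{j_{l,l+1}}(Λ_{j_{l,l+1}}),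
j_{l,l+1} = min{j_l, j_{l+1}}**: every bond of it is a Λ_{j_{l,l+1}}-bond; and |j_l − j_{l+1}| ≤ 1.
[cite: Balaban1984PropagatorsII, (2.47) p.231] -/
theorem X_facts (hsep : Separates G zone) (hSc : ∀ ⦃j : ℕ⦄ ⦃y : V⦄, OnSurf G zone j y → S j y) (p : G.Walk x x') {l : ℕ} (hl : l ≤ m S zone p) :
    (∀ i, bIdx S zone p l ≤ i → i < eIdx S zone p (l + 1) →
      min (zone (p.getVert i)) (zone (p.getVert (i + 1))) = min (js S zone p l) (js S zone p (l + 1))) ∧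
    js S zone p l ≤ js S zone p (l + 1) + 1 ∧ js S zone p (l + 1) ≤ js S zone p l + 1 := by
  have hst := bIdx_le_eIdx_succ p hl
  have htn := eIdx_le_length (S := S) (zone := zone) p (l + 1)
  have hfree : ∀ i, bIdx S zone p l < i → i < eIdx S zone p (l + 1) → ¬ SurfAt S p i := fun i h1 h2 =>
    not_surfAt_X p hl h1 (Nat.lt_of_lt_of_le h2 (min_le_left _ _)) (by omega)
  have hexcl : bIdx S zone p l < eIdx S zone p (l + 1) → SurfAt S p (bIdx S zone p l) →
      SurfAt S p (eIdx S zone p (l + 1)) → zone (p.getVert (bIdx S zone p l)) ≠ zone (p.getVert (eIdx S zone p (l + 1))) := by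
    intro hlt hs ht
    rcases Nat.eq_zero_or_pos l with rfl | hl1
    · -- y itself is surface-free (else a₁ = 0 = b₀)
      exfalso
      rw [bIdx_zero] at hs hlt
      exact not_surfAt_of_lt_aIdx_one p (Nat.lt_of_lt_of_le hlt (min_le_left _ _)) hs
    · rcases Nat.lt_or_ge (l + 1) (m S zone p + 1) with hlm | hlm
      · -- next episode: a different surface
        rw [zone_getVert_bIdx (S := S) (zone := zone) p hl, zone_getVert_eIdx (S := S) (zone := zone) p (l + 1)]
        exact (js_succ_ne p hl1 (by omega)).symm
      · -- the tail: y′ is surface-free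
        exfalso
        obtain rfl : l = m S zone p := by omega
        rw [eIdx_m_succ] at ht hlt
        exact not_surfAt_tail p hlt le_rfl ht
  obtain ⟨hmin, h1, h2, -, -⟩ := stretch hsep hSc p hst htn hfree hexcl
  rw [zone_getVert_bIdx (S := S) (zone := zone) p hl, zone_getVert_eIdx (S := S) (zone := zone) p (l + 1)] at hmin h1 h2
  exact ⟨hmin, h1, h2⟩

/-- **y₁ ∈ Σ_j ∪ Σ_{j+1}**: j ≤ j₁ ≤ j + 1 (y surface-free is the lower end of Γ_{y,y₁}). [cite: Balaban1984PropagatorsII, (2.47) p.231] -/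
theorem js_one_bounds (hsep : Separates G zone) (hSc : ∀ ⦃j : ℕ⦄ ⦃y : V⦄, OnSurf G zone j y → S j y) (p : G.Walk x x') :
    zone x ≤ js S zone p 1 ∧ js S zone p 1 ≤ zone x + 1 := by
  have hX := X_facts hsep hSc p (l := 0) (Nat.zero_le _)
  rw [js_zero] at hX
  refine ⟨?_, hX.2.2⟩
  rcases Nat.eq_zero_or_pos (eIdx S zone p 1) with h0 | hpos
  · have : js S zone p 1 = zone x := by rw [← zone_getVert_eIdx (S := S) (zone := zone) p 1, h0, p.getVert_zero]
    omega
  · have hfree : ∀ i, 0 < i → i < eIdx S zone p 1 → ¬ SurfAt S p i := fun i _ h2 =>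
      not_surfAt_of_lt_aIdx_one p (Nat.lt_of_lt_of_le h2 (min_le_left _ _))
    have h0 : ¬ SurfAt S p 0 := not_surfAt_of_lt_aIdx_one p (Nat.lt_of_lt_of_le hpos (min_le_left _ _))
    obtain ⟨-, -, -, h, -⟩ := stretch hsep hSc p (Nat.zero_le _) (eIdx_le_length p 1) hfree (fun _ hs => absurd hs h0)
    have := h hpos h0
    rwa [p.getVert_zero, zone_getVert_eIdx (S := S) (zone := zone) p 1] at this

/-- **The last surface is Σ_{j′} or Σ_{j′+1}**: j′ ≤ j_m ≤ j′ + 1 (y′ surface-free is the lower end of Γ_{y′_m,y′};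
for m = 0 this reads j′ ≤ j ≤ j′ + 1). [cite: Balaban1984PropagatorsII, (2.47) p.231] -/
theorem js_m_bounds (hsep : Separates G zone) (hSc : ∀ ⦃j : ℕ⦄ ⦃y : V⦄, OnSurf G zone j y → S j y) (p : G.Walk x x') :
    zone x' ≤ js S zone p (m S zone p) ∧ js S zone p (m S zone p) ≤ zone x' + 1 := by
  have hX := X_facts hsep hSc p (l := m S zone p) le_rfl
  rw [js_m_succ] at hX
  refine ⟨?_, hX.2.1⟩
  set s := bIdx S zone p (m S zone p)
  have hsn : s ≤ p.length := bIdx_le_length p le_rfl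
  rcases hsn.eq_or_lt with h | hlt
  · have : js S zone p (m S zone p) = zone x' := by
      rw [← zone_getVert_bIdx (S := S) (zone := zone) p le_rfl, show bIdx S zone p (m S zone p) = s from rfl, h, p.getVert_of_length_le le_rfl]
    omega
  · have hfree : ∀ i, s < i → i < p.length → ¬ SurfAt S p i := fun i h1 h2 => not_surfAt_tail p h1 h2.le
    have hn : ¬ SurfAt S p p.length := not_surfAt_tail p hlt le_rfl
    obtain ⟨-, -, -, -, h⟩ := stretch hsep hSc p hsn le_rfl hfree (fun _ _ ht => absurd ht hn)
    have := h hlt hn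
    rwa [p.getVert_of_length_le le_rfl, zone_getVert_bIdx (S := S) (zone := zone) p le_rfl] at this

/-- **|j_l − j_{l+1}| = 1** for consecutive episodes (1 ≤ l < m). [cite: Balaban1984PropagatorsII, (2.47) p.231] -/
theorem js_step (hsep : Separates G zone) (hSc : ∀ ⦃j : ℕ⦄ ⦃y : V⦄, OnSurf G zone j y → S j y) (p : G.Walk x x') {l : ℕ} (hl1 : 1 ≤ l) (hl : l + 1 ≤ m S zone p) :
    js S zone p (l + 1) + 1 = js S zone p l ∨ js S zone p l + 1 = js S zone p (l + 1) := by
  have hX := X_facts hsep hSc p (l := l) (by omega)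
  have hne := js_succ_ne p hl1 hl
  omega

/-- **Γ_{y_l,y′_l} is contained in B^{j_l}(Λ_{j_l}) ∪ B^{j_l−1}(Λ_{j_l−1})**: every point of it has zone j_l or j_l − 1.
[cite: Balaban1984PropagatorsII, (2.47) p.231] -/
theorem S_zone (hsep : Separates G zone) (hSc : ∀ ⦃j : ℕ⦄ ⦃y : V⦄, OnSurf G zone j y → S j y) (p : G.Walk x x') {l : ℕ} (hl1 : 1 ≤ l) (hl : l ≤ m S zone p) :
    ∀ i, aIdx S zone p l ≤ i → i ≤ bIdx S zone p l →
      zone (p.getVert i) ≤ js S zone p l ∧ js S zone p l ≤ zone (p.getVert i) + 1 := by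
  intro i hi1 hi2
  induction i, hi1 using Nat.le_induction with
  | base => exact ⟨le_of_eq rfl, by simp [js]⟩
  | succ i hai ih =>
    have ih' := ih (by omega)
    have hbn := bIdx_le_length p hl
    have hadj : G.Adj (p.getVert i) (p.getVert (i + 1)) := p.adj_getVert_succ (by omega)
    have hb := hsep hadj
    rcases Nat.lt_trichotomy (zone (p.getVert (i + 1))) (zone (p.getVert i)) with h | h | h
    · -- a drop: v_i is on S_{zone v_i} = S_{j_l}
      have hs : SurfAt S p i := surfAt_of_onSomeSurf hSc p ⟨p.getVert (i + 1), hadj.symm, by omega⟩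
      have := zone_eq_js_of_surfAt_S p hl1 hl hai (by omega) hs
      omega
    · rw [h]; exact ih'
    · -- a rise: v_{i+1} is on S_{zone v_{i+1}} = S_{j_l}
      have hs : SurfAt S p (i + 1) := surfAt_of_onSomeSurf hSc p ⟨p.getVert i, hadj, by omega⟩
      have := zone_eq_js_of_surfAt_S p hl1 hl (by omega) hi2 hs
      omega

/-- Hence every bond of Γ_{y_l,y′_l} is a Λ_{j_l}- or a Λ_{j_l−1}-bond. [cite: Balaban1984PropagatorsII, (2.47) p.231] -/
theorem S_bond_le (hsep : Separates G zone) (hSc : ∀ ⦃j : ℕ⦄ ⦃y : V⦄, OnSurf G zone j y → S j y) (p : G.Walk x x') {l : ℕ} (hl1 : 1 ≤ l) (hl : l ≤ m S zone p)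
    {i : ℕ} (hi1 : aIdx S zone p l ≤ i) (hi2 : i < bIdx S zone p l) :
    min (zone (p.getVert i)) (zone (p.getVert (i + 1))) ≤ js S zone p l :=
  min_le_of_left_le (S_zone hsep hSc p hl1 hl i hi1 hi2.le).1

end Walk

/-! ## 3. (2.48) for the S-decomposition -/

section Metric

variable {V : Type*} {G : SimpleGraph V} {zone : V → ℕ} {S : ℕ → V → Prop} {x x' : V}
variable {X : Type*} [PseudoMetricSpace X]

variable {pos : V → X} {ℓ : ℕ → ℝ}

/-- **(2.48), FIRST LINE** (p. 232 [10], verbatim: *"From this decomposition and the definition (2.46) we get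
d(y, y′) ≥ (L^jη)^{−1}|Γ_{y,y₁}| + Σ_{l=1}^m (L^{j_l}η)^{−1}|Γ_{y_l,y′_l}| + Σ_{l=1}^m (L^{j_{l,l+1}}η)^{−1}|Γ_{y′_l,y_{l+1}}|"*),
KERNEL-DERIVED for EVERY admissible contour Γ from y to y′ in place of the minimising one (its number of admissible
bonds |Γ|_bonds ≥ the right-hand side; for a shortest contour |Γ|_bonds = d(y, y′), `ineq248_dist`), over a zoned graph
of admissible bonds with Σ_j separating (`B6Geometry.Separates`) and drawn with bond lengths ≤ ℓ (zone) (`BondScale`,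
ℓ monotone and positive; ℓ j = L^jη in print): j = zone y, m, y_l = Γ(e_l), y′_l = Γ(b_l), j_l as constructed in §2.
[cite: Balaban1984PropagatorsII, (2.48) p.232] -/
theorem ineq248_line1 (hsep : Separates G zone) (hSc : ∀ ⦃j : ℕ⦄ ⦃y : V⦄, OnSurf G zone j y → S j y) (hlen : BondScale G zone pos ℓ)
    (hmono : Monotone ℓ)
    (hℓ : ∀ q, 0 < ℓ q) (p : G.Walk x x') :
    (ℓ (zone x))⁻¹ * len pos p 0 (eIdx S zone p 1)
      + ∑ l ∈ Finset.Icc 1 (m S zone p), (ℓ (js S zone p l))⁻¹ * len pos p (eIdx S zone p l) (bIdx S zone p l)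
      + ∑ l ∈ Finset.Icc 1 (m S zone p),
          (ℓ (min (js S zone p l) (js S zone p (l + 1))))⁻¹ * len pos p (bIdx S zone p l) (eIdx S zone p (l + 1))
      ≤ (p.length : ℝ) := by
  set M := m S zone p with hM
  set e := eIdx S zone p with he
  set b := bIdx S zone p with hb
  -- the three families of portions, bond by bond
  have h0 : (ℓ (zone x))⁻¹ * len pos p 0 (e 1) ≤ (e 1 : ℝ) - (0 : ℕ) := by
    have hX := (X_facts hsep hSc p (l := 0) (Nat.zero_le _)).1
    have hj := (js_one_bounds hsep hSc p).1
    rw [js_zero, bIdx_zero] at hX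
    refine inv_mul_len_le hlen hmono hℓ p (Nat.zero_le _) (eIdx_le_length p 1) fun i hi1 hi2 => ?_
    rw [hX i hi1 hi2]
    exact min_le_left _ _
  have hS : ∀ l ∈ Finset.Icc 1 M, (ℓ (js S zone p l))⁻¹ * len pos p (e l) (b l) ≤ (b l : ℝ) - e l := by
    intro l hl
    rw [Finset.mem_Icc] at hl
    rw [he, eIdx_of_le p hl.1 hl.2]
    exact inv_mul_len_le hlen hmono hℓ p (aIdx_le_bIdx p hl.1 hl.2) (bIdx_le_length p hl.2)
      fun i hi1 hi2 => S_bond_le hsep hSc p hl.1 hl.2 hi1 hi2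
  have hXl : ∀ l ∈ Finset.Icc 1 M,
      (ℓ (min (js S zone p l) (js S zone p (l + 1))))⁻¹ * len pos p (b l) (e (l + 1)) ≤ (e (l + 1) : ℝ) - b l := by
    intro l hl
    rw [Finset.mem_Icc] at hl
    have hX := (X_facts hsep hSc p (l := l) hl.2).1
    exact inv_mul_len_le hlen hmono hℓ p (bIdx_le_eIdx_succ p hl.2) (eIdx_le_length p (l + 1))
      fun i hi1 hi2 => (hX i hi1 hi2).le
  -- telescoping: e 1 + S_{l=1}^m (e (l+1) − e l) = e (m+1) = |Γ|
  have htel : ∑ l ∈ Finset.Icc 1 M, ((e (l + 1) : ℝ) - e l) = (e (M + 1) : ℝ) - e 1 := by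
    rw [← Finset.Ico_add_one_right_eq_Icc, Finset.sum_Ico_eq_sum_range]
    simp only [Nat.add_sub_cancel]
    have := Finset.sum_range_sub (fun i => (e (i + 1) : ℝ)) M
    simpa [add_comm, add_assoc] using this
  have hend : (e (M + 1) : ℝ) = p.length := by rw [he, hM, eIdx_m_succ]
  calc (ℓ (zone x))⁻¹ * len pos p 0 (e 1)
        + ∑ l ∈ Finset.Icc 1 M, (ℓ (js S zone p l))⁻¹ * len pos p (e l) (b l)
        + ∑ l ∈ Finset.Icc 1 M, (ℓ (min (js S zone p l) (js S zone p (l + 1))))⁻¹ * len pos p (b l) (e (l + 1))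
      ≤ ((e 1 : ℝ) - (0 : ℕ)) + ∑ l ∈ Finset.Icc 1 M, ((b l : ℝ) - e l)
        + ∑ l ∈ Finset.Icc 1 M, ((e (l + 1) : ℝ) - b l) :=
          add_le_add (add_le_add h0 (Finset.sum_le_sum hS)) (Finset.sum_le_sum hXl)
    _ = (e 1 : ℝ) + ∑ l ∈ Finset.Icc 1 M, ((e (l + 1) : ℝ) - e l) := by
          rw [Nat.cast_zero, sub_zero, add_assoc, ← Finset.sum_add_distrib]
          congr 1
          exact Finset.sum_congr rfl fun l _ => by ring
    _ = (p.length : ℝ) := by rw [htel, hend]; ring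

/-- **(2.48), SECOND LINE** (p. 232 [10], verbatim: *"≥ (L^jη)^{−1}|y − y₁| + Σ_{l=1}^m (L^{j_l}η)^{−1}|y_l − y′_l| +
Σ_{l=1}^m (L^{j_{l,l+1}}η)^{−1}|y′_l − y_{l+1}|. (2.48)"*): each portion is at least as long as its end-points are
apart. [cite: Balaban1984PropagatorsII, (2.48) p.232] -/
theorem ineq248_line2 (hℓ : ∀ q, 0 < ℓ q) (p : G.Walk x x') :
    (ℓ (zone x))⁻¹ * dist (pos x) (pos (p.getVert (eIdx S zone p 1)))
      + ∑ l ∈ Finset.Icc 1 (m S zone p),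
          (ℓ (js S zone p l))⁻¹ * dist (pos (p.getVert (eIdx S zone p l))) (pos (p.getVert (bIdx S zone p l)))
      + ∑ l ∈ Finset.Icc 1 (m S zone p), (ℓ (min (js S zone p l) (js S zone p (l + 1))))⁻¹
          * dist (pos (p.getVert (bIdx S zone p l))) (pos (p.getVert (eIdx S zone p (l + 1))))
      ≤ (ℓ (zone x))⁻¹ * len pos p 0 (eIdx S zone p 1)
      + ∑ l ∈ Finset.Icc 1 (m S zone p), (ℓ (js S zone p l))⁻¹ * len pos p (eIdx S zone p l) (bIdx S zone p l)
      + ∑ l ∈ Finset.Icc 1 (m S zone p),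
          (ℓ (min (js S zone p l) (js S zone p (l + 1))))⁻¹ * len pos p (bIdx S zone p l) (eIdx S zone p (l + 1)) := by
  have hw : ∀ q, 0 ≤ (ℓ q)⁻¹ := fun q => inv_nonneg.mpr (hℓ q).le
  refine add_le_add (add_le_add ?_ (Finset.sum_le_sum fun l hl => ?_)) (Finset.sum_le_sum fun l hl => ?_)
  · have := dist_le_len pos p (Nat.zero_le (eIdx S zone p 1))
    rw [p.getVert_zero] at this
    exact mul_le_mul_of_nonneg_left this (hw _)
  · rw [Finset.mem_Icc] at hl
    exact mul_le_mul_of_nonneg_left (dist_le_len pos p (eIdx_le_bIdx p hl.1 hl.2)) (hw _)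
  · rw [Finset.mem_Icc] at hl
    exact mul_le_mul_of_nonneg_left (dist_le_len pos p (bIdx_le_eIdx_succ p hl.2)) (hw _)

/-- The right-hand side of the first line of (2.48) (lengths of the portions). [cite: Balaban1984PropagatorsII, (2.48) p.232] -/
noncomputable def rhs248Len (S : ℕ → V → Prop) (zone : V → ℕ) (pos : V → X) (ℓ : ℕ → ℝ) (p : G.Walk x x') : ℝ :=
  (ℓ (zone x))⁻¹ * len pos p 0 (eIdx S zone p 1)
    + ∑ l ∈ Finset.Icc 1 (m S zone p), (ℓ (js S zone p l))⁻¹ * len pos p (eIdx S zone p l) (bIdx S zone p l)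
    + ∑ l ∈ Finset.Icc 1 (m S zone p),
        (ℓ (min (js S zone p l) (js S zone p (l + 1))))⁻¹ * len pos p (bIdx S zone p l) (eIdx S zone p (l + 1))

/-- The right-hand side of the second line of (2.48) (distances of the points y, y₁, y′₁, …, y_m, y′_m, y′).
[cite: Balaban1984PropagatorsII, (2.48) p.232] -/
noncomputable def rhs248Pts (S : ℕ → V → Prop) (zone : V → ℕ) (pos : V → X) (ℓ : ℕ → ℝ) (p : G.Walk x x') : ℝ :=
  (ℓ (zone x))⁻¹ * dist (pos x) (pos (p.getVert (eIdx S zone p 1)))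
    + ∑ l ∈ Finset.Icc 1 (m S zone p),
        (ℓ (js S zone p l))⁻¹ * dist (pos (p.getVert (eIdx S zone p l))) (pos (p.getVert (bIdx S zone p l)))
    + ∑ l ∈ Finset.Icc 1 (m S zone p), (ℓ (min (js S zone p l) (js S zone p (l + 1))))⁻¹
        * dist (pos (p.getVert (bIdx S zone p l))) (pos (p.getVert (eIdx S zone p (l + 1))))

/-- **(2.48) for every admissible contour**: |Γ|_bonds ≥ (2.48)₁ ≥ (2.48)₂. [cite: Balaban1984PropagatorsII, (2.48) p.232] -/
theorem ineq248_walk (hsep : Separates G zone) (hSc : ∀ ⦃j : ℕ⦄ ⦃y : V⦄, OnSurf G zone j y → S j y) (hlen : BondScale G zone pos ℓ)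
    (hmono : Monotone ℓ)
    (hℓ : ∀ q, 0 < ℓ q) (p : G.Walk x x') :
    rhs248Pts S zone pos ℓ p ≤ rhs248Len S zone pos ℓ p ∧ rhs248Len S zone pos ℓ p ≤ (p.length : ℝ) :=
  ⟨ineq248_line2 hℓ p, ineq248_line1 hsep hSc hlen hmono hℓ p⟩

/-- **(2.48) AS PRINTED, for the distance (2.46)** (p. 231: *"Of course the infimum is attained at some contour
Γ_{y,y′}"*; p. 232: *"From this decomposition and the definition (2.46) we get d(y, y′) ≥ … ≥ … (2.48)"*): for two
lattice points joined by admissible contours there is a shortest admissible contour Γ_{y,y′}, d(y, y′) = |Γ_{y,y′}|_bonds,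
and its decomposition (2.47) gives both lines of (2.48). [cite: Balaban1984PropagatorsII, (2.46)–(2.48) pp.231–232] -/
theorem ineq248_dist (hsep : Separates G zone) (hSc : ∀ ⦃j : ℕ⦄ ⦃y : V⦄, OnSurf G zone j y → S j y) (hlen : BondScale G zone pos ℓ)
    (hmono : Monotone ℓ)
    (hℓ : ∀ q, 0 < ℓ q) (hxx : G.Reachable x x') :
    ∃ p : G.Walk x x', p.length = G.dist x x' ∧
      rhs248Pts S zone pos ℓ p ≤ rhs248Len S zone pos ℓ p ∧ rhs248Len S zone pos ℓ p ≤ (G.dist x x' : ℝ) := by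
  obtain ⟨p, hp⟩ := hxx.exists_walk_length_eq_dist
  refine ⟨p, hp, ineq248_line2 hℓ p, ?_⟩
  rw [← hp]
  exact ineq248_line1 hsep hSc hlen hmono hℓ p

end Metric

/-! ## 4. (2.47) assembled for the surface family S; contour systems; the tower -/

section Assembly

variable {V : Type*} {G : SimpleGraph V} {zone : V → ℕ} {S : ℕ → V → Prop} {x x' : V}

/-- **(2.47)** (p. 231 [9], verbatim: *"Continuing this way we obtain a sequence of points y, y₁, y′₁, y₂, y′₂, …, y_m,
y′_m, y′ on Γ_{y,y′}, and a sequence of indices j, j₁, j₂, …, j_m, j′ with the following properties: Γ_{y,y′} = Γ_{y,y₁}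
∪ ⋃_{l=1}^m (Γ_{y_l,y′_l} ∪ Γ_{y′_l,y_{l+1}}), y_{m+1} = y′, (2.47) y_l, y′_l ∈ Σ_{j_l}, Γ_{y_l,y′_l} does not intersect any
other surface Σ_j, j ≠ j_l, Γ_{y′_l,y_{l+1}} connects the surface Σ_{j_l} with the surface Σ_{j_{l+1}} and is contained in
B^{j_{l,l+1}}(Λ_{j_{l,l+1}}), where j_{l,l+1} = min{j_l, j_{l+1}}, |j_l − j_{l+1}| = 1."*; and *"The contour Γ_{y,y′}
starts at y and intersects either the surface Σ_j, or the surface Σ_{j+1}, the first time at a point y₁"*), KERNEL-DERIVED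
for EVERY admissible contour Γ = (v₀, …, v_n) from y = v₀ to y′ = v_n in a zoned graph of admissible bonds in which
Σ_j separates, RELATIVE TO AN ARBITRARY FAMILY `S` OF SURFACE POINT SETS with (α) `hSz` (Σ_j-points are zone-j points)
and (β) `hSc` (crossing points are Σ_j-points): with the indices 0 = b₀ ≤ e₁ ≤ b₁ < e₂ ≤ b₂ < … < e_m ≤ b_m ≤ e_{m+1} = n of §2 (y_l = v_{e_l},
y′_l = v_{b_l}; the portions are the index intervals, so (2.47) as a union holds by construction) —
(i) y_l, y′_l ∈ Σ_{j_l}; (ii) no point of Γ_{y_l,y′_l} lies on a surface Σ_j with j ≠ j_l; (iii) every bond of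
Γ_{y′_l,y_{l+1}} (l = 0, …, m; y′₀ := y) is a Λ_{min{j_l,j_{l+1}}}-bond and its interior points lie on no surface;
(iv) |j_l − j_{l+1}| = 1 (1 ≤ l < m); (v) j₁ ∈ {j, j + 1} and j_m ∈ {j′, j′ + 1}, j₀ = j = zone y, j_{m+1} = j′ = zone y′;
(vi) no point of Γ_{y,y₁} before y₁ lies on a surface. [cite: Balaban1984PropagatorsII, (2.47) p.231] -/
theorem decomp247 (hsep : Separates G zone) (hSz : ∀ ⦃j : ℕ⦄ ⦃y : V⦄, S j y → zone y = j) (hSc : ∀ ⦃j : ℕ⦄ ⦃y : V⦄, OnSurf G zone j y → S j y) 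
    (p : G.Walk x x') :
    bIdx S zone p 0 = 0 ∧ eIdx S zone p (m S zone p + 1) = p.length ∧
    (∀ l, 1 ≤ l → l ≤ m S zone p → eIdx S zone p l ≤ bIdx S zone p l) ∧
    (∀ l, l ≤ m S zone p → bIdx S zone p l ≤ eIdx S zone p (l + 1)) ∧
    (∀ l, 1 ≤ l → l ≤ m S zone p →
      S (js S zone p l) (p.getVert (eIdx S zone p l)) ∧ S (js S zone p l) (p.getVert (bIdx S zone p l))) ∧
    (∀ l, 1 ≤ l → l ≤ m S zone p → ∀ i, eIdx S zone p l ≤ i → i ≤ bIdx S zone p l →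
      ∀ j, j ≠ js S zone p l → ¬ S j (p.getVert i)) ∧
    (∀ l, l ≤ m S zone p → ∀ i, bIdx S zone p l ≤ i → i < eIdx S zone p (l + 1) →
      min (zone (p.getVert i)) (zone (p.getVert (i + 1))) = min (js S zone p l) (js S zone p (l + 1))) ∧
    (∀ l, l ≤ m S zone p → ∀ i, bIdx S zone p l < i → i < eIdx S zone p (l + 1) → ¬ SurfAt S p i) ∧
    (∀ l, 1 ≤ l → l + 1 ≤ m S zone p →
      js S zone p (l + 1) + 1 = js S zone p l ∨ js S zone p l + 1 = js S zone p (l + 1)) ∧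
    (js S zone p 0 = zone x ∧ js S zone p (m S zone p + 1) = zone x' ∧
      zone x ≤ js S zone p 1 ∧ js S zone p 1 ≤ zone x + 1 ∧
      zone x' ≤ js S zone p (m S zone p) ∧ js S zone p (m S zone p) ≤ zone x' + 1) ∧
    (∀ i, i < eIdx S zone p 1 → ¬ SurfAt S p i) := by
  refine ⟨bIdx_zero p, eIdx_m_succ p, fun l hl1 hl => eIdx_le_bIdx p hl1 hl, fun l hl => bIdx_le_eIdx_succ p hl,
    fun l hl1 hl => ⟨?_, onSurf_bIdx hSz p hl1 hl⟩, fun l hl1 hl i hi1 hi2 j hj => ?_, fun l hl => (X_facts hsep hSc p hl).1,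
    fun l hl i hi1 hi2 => ?_, fun l hl1 hl => js_step hsep hSc p hl1 hl,
    ⟨js_zero p, js_m_succ p, (js_one_bounds hsep hSc p).1, (js_one_bounds hsep hSc p).2, (js_m_bounds hsep hSc p).1,
      (js_m_bounds hsep hSc p).2⟩, fun i hi => ?_⟩
  · rw [getVert_eIdx]; exact onSurf_aIdx hSz p hl1 hl
  · rw [eIdx_of_le p hl1 hl] at hi1
    exact not_onSurf_S hSz p hl1 hl hi1 hi2 hj
  · exact not_surfAt_X p hl hi1 (Nat.lt_of_lt_of_le hi2 (min_le_left _ _))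
      (Nat.le_trans hi2.le (eIdx_le_length p (l + 1)))
  · exact not_surfAt_of_lt_aIdx_one p (Nat.lt_of_lt_of_le hi (min_le_left _ _))

/-- NON-VACUITY OF (α), (β), lower extreme: the crossing points themselves, `S := OnSurf G zone` — the reading of
`…B6Decomp247Surfaces` — satisfy (α) and (β). [cite: Balaban1984PropagatorsII, p.231] -/
theorem admissible_onSurf (G : SimpleGraph V) (zone : V → ℕ) :
    (∀ ⦃j : ℕ⦄ ⦃y : V⦄, OnSurf G zone j y → zone y = j) ∧ (∀ ⦃j : ℕ⦄ ⦃y : V⦄, OnSurf G zone j y → OnSurf G zone j y) :=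
  ⟨fun _ _ h => h.1, fun _ _ h => h⟩

/-- NON-VACUITY OF (α), (β), upper extreme: ALL points of B^j(Λ_j) declared surface points, `S j x := zone x = j` (every
point a surface point; the episodes are the maximal runs of constant zone, every crossing portion a single bond), satisfy
(α) and (β). [cite: Balaban1984PropagatorsII, p.231] -/
theorem admissible_allPoints (G : SimpleGraph V) (zone : V → ℕ) :
    (∀ ⦃j : ℕ⦄ ⦃y : V⦄, zone y = j → zone y = j) ∧ (∀ ⦃j : ℕ⦄ ⦃y : V⦄, OnSurf G zone j y → zone y = j) :=
  ⟨fun _ _ h => h, fun _ _ h => h.1⟩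

/- (2.47) for the two extreme families, by name. -/
example (hsep : Separates G zone) (p : G.Walk x x') :=
  decomp247 (S := OnSurf G zone) hsep (admissible_onSurf G zone).1 (admissible_onSurf G zone).2 p

example (hsep : Separates G zone) (p : G.Walk x x') :=
  decomp247 (S := fun j y => zone y = j) hsep (admissible_allPoints G zone).1 (admissible_allPoints G zone).2 p

variable {g : B6.Geometry} {X : Type*} [PseudoMetricSpace X]

/-- **(2.47)–(2.48) over a contour system realising (2.46)** (`B6Geometry.ContourSystem`/`Realizes`, the typed
generality of d(y, y′) in the tree): for a geometry `g` whose distance IS (2.46), admissible contours existing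
(`Connected`), Σ_j separating (`Separates`), drawn in a (pseudo)metric space with Λ_j-bonds of length ≤ L^jη
(`B6LevelGapMetric.BondScale22`), L ≥ 1, η > 0: for all y, y′ ∈ 𝔅 there is a shortest admissible contour Γ_{y,y′},
d(y, y′) = |Γ_{y,y′}|_bonds, its decomposition (2.47) holds (`decomp247`) and d(y, y′) ≥ (2.48)₁ ≥ (2.48)₂ with
j = scale y. [cite: Balaban1984PropagatorsII, (2.46)–(2.48) pp.231–232] -/
theorem ineq248_of_realizes {C : ContourSystem g} (h : Realizes g C) (hconn : C.bond.Connected)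
    (hsep : Separates C.bond C.zone) {S : ℕ → C.Pt → Prop} (hSc : ∀ ⦃j : ℕ⦄ ⦃y : C.Pt⦄, OnSurf C.bond C.zone j y → S j y)
    {pos : C.Pt → X} (hlen : BondScale22 C pos) (hL : 1 ≤ g.L) (hη : 0 < g.eta) (y y' : g.Site) :
    ∃ p : C.bond.Walk (C.ι y) (C.ι y'), (p.length : ℝ) = g.dist y y' ∧ C.zone (C.ι y) = g.scale y ∧
      rhs248Pts S C.zone pos (fun j => g.L ^ j * g.eta) p ≤ rhs248Len S C.zone pos (fun j => g.L ^ j * g.eta) p ∧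
      rhs248Len S C.zone pos (fun j => g.L ^ j * g.eta) p ≤ g.dist y y' := by
  obtain ⟨hmono, hpos⟩ := scaleLen_mono_pos hL hη
  obtain ⟨p, hp, h2, h1⟩ := ineq248_dist (zone := C.zone) hsep hSc hlen hmono hpos (hconn (C.ι y) (C.ι y'))
  have hd : g.dist y y' = (C.bond.dist (C.ι y) (C.ι y') : ℝ) := h y y'
  refine ⟨p, ?_, C.zone_ι y, h2, ?_⟩
  · rw [hd, hp]
  · rw [hd]; exact h1

end Assembly

section Tower

open B6LevelTower

variable (d : ℕ) [NeZero d] (k a mm L : ℕ) (η R : ℝ)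

/-- **(2.47)–(2.48) on the coordinatised (k+1)-level tower** of `B6LevelTower` (sites `TW d k a`, levels = zones,
admissible bonds = `graph L`, drawing `tposR L η` in ℝ^d with each Λ_j-bond of length exactly L^jη): the tower realises
(2.46) (`twGeo_realizes`), its contours exist (`twCS_connected`), Σ_j separates (`twCS_separates`) and (len) holds
(`twCS_bondScale22`), so §5 applies BY NAME: for all sites y, y′ a shortest admissible contour exists, d(y, y′) = its
bond count, (2.47) holds for it and d(y, y′) ≥ (2.48)₁ ≥ (2.48)₂ (L ≥ 1, η > 0). [cite: Balaban1984PropagatorsII, (2.46)–(2.48) pp.231–232] -/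
theorem ineq248_tower (hL : 1 ≤ L) (hη : 0 < η) {S : ℕ → TW d k a → Prop}
    (hSc : ∀ ⦃j : ℕ⦄ ⦃y : TW d k a⦄, OnSurf (twCS d k a mm L η R).bond (twCS d k a mm L η R).zone j y → S j y)
    (y y' : TW d k a) :
    ∃ p : (twCS d k a mm L η R).bond.Walk y y',
      (p.length : ℝ) = (twGeo d k a mm L η R).dist y y' ∧
      rhs248Pts S (twCS d k a mm L η R).zone (tposR L η) (fun j => (L : ℝ) ^ j * η) p
        ≤ rhs248Len S (twCS d k a mm L η R).zone (tposR L η) (fun j => (L : ℝ) ^ j * η) p ∧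
      rhs248Len S (twCS d k a mm L η R).zone (tposR L η) (fun j => (L : ℝ) ^ j * η) p
        ≤ (twGeo d k a mm L η R).dist y y' := by
  have hL' : (1 : ℝ) ≤ (twGeo d k a mm L η R).L := by
    show (1 : ℝ) ≤ (L : ℝ); exact_mod_cast hL
  obtain ⟨p, hp, -, h2, h1⟩ := ineq248_of_realizes (twGeo_realizes (d := d) (k := k) (a := a) (m := mm) (L := L)
    (η := η) (R := R)) (twCS_connected d k a mm L η R) (twCS_separates d k a mm L η R)
    hSc (twCS_bondScale22 d k a mm L η R hη.le) hL' hη y y'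
  exact ⟨p, hp, h2, h1⟩

/- The S-decomposition (2.47) of every admissible contour of the tower: `decomp247 (twCS_separates …) hSz hSc p`. -/
example {S : ℕ → TW d k a → Prop} (hSz : ∀ ⦃j : ℕ⦄ ⦃y : TW d k a⦄, S j y → (twCS d k a mm L η R).zone y = j)
    (hSc : ∀ ⦃j : ℕ⦄ ⦃y : TW d k a⦄, OnSurf (twCS d k a mm L η R).bond (twCS d k a mm L η R).zone j y → S j y)
    (y y' : TW d k a) (p : (twCS d k a mm L η R).bond.Walk y y') :=
  decomp247 (twCS_separates d k a mm L η R) hSz hSc p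

end Tower

end Literature.MathematicalPhysics.QuantumFieldTheory.Balaban1983to89.B6Decomp247AnySurfaces
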